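import Summits.AtomisticToContinuum.HydrodynamicLimit.Theses.LambertianContactSwap
import Summits.AtomisticToContinuum.HydrodynamicLimit.Theorems.LambertianContactSwapLocalGibbsProbability
import Summits.AtomisticToContinuum.HydrodynamicLimit.Theorems.LambertianContactSwapContactAngleEquidistributionDomination
import Summits.AtomisticToContinuum.HydrodynamicLimit.Theorems.LambertianContactSwapContactAngleEquidistributionMeas
import Summits.AtomisticToContinuum.HydrodynamicLimit.Theorems.LambertianContactSwapContactAngleEquidistributionAbstractDV
import Summits.AtomisticToContinuum.HydrodynamicLimit.Theorems.LambertianContactSwapContactAngleEquidistributionNearFieldBall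
import Literature.Analysis.FluidPDE.HardSphereFlowMeasurable
import Literature.MathematicalPhysics.KineticTheory.HardSphereEulerProofs
import Summits.AtomisticToContinuum.HydrodynamicLimit.Theorems.LambertianContactSwapContactAngleEquidistributionTransferTools
import HarnessLib

/-!
# The transfer kernel of line `Sketch`: the crux `ContactAngleEquidistribution` from four named statements
# (crux stmt-AtomisticToContinuum-12097, route LambertianContactSwap; lead c4, cycle 5)

Helper file (`--supports stmt-AtomisticToContinuum-12097`). This is the KERNEL-CHECKED COMPOSITION of the transfer
line `Sketch` (skeleton `Cruxes/ContactAngleEquidistribution/Lines/Sketch.lean` v7.1, theorem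
`ContactAngleEquidistribution_of`), landed with its four open stubs turned into HYPOTHESES so that the planner can
re-file the crux as a conditional bridge citing ONE tree theorem (`contactAngleEquidistribution_of_kernel`):

  `EqIsolatedAngleMGF ∧ NearFieldAdmissibleCosineLawBall ∧ NearFieldBlockingIsotropyBall ∧ CollisionMomentBound
     ⟹ ContactAngleEquidistribution`,

where `EqIsolatedAngleMGF` is the statement of the skeleton's `stub_cost` (written INLINE as the type of the
hypothesis `hcost`; no definition is introduced): under the homogeneous Gibbs law at temperature `θe` the ISOLATED
(no third centre within `3ε` of the contact midpoint) speed-capped `κ_g`-centred contact-angle functional is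
sub-Gaussian at the CLT scale `(N+1)^{4/3}` around a vanishing mean; `NearFieldAdmissibleCosineLawBall` (T1') and
`NearFieldBlockingIsotropyBall` (T2') are the near-field statements of `…NearFieldBall.lean` (reduction
`stub_nearFieldReductionBall`, p115592); `CollisionMomentBound` is the route's support item stmt-12102. All four are
OPEN-PROBLEM CLASS out of equilibrium (fixed-density one-sided molecular chaos; Gibbs-typical collision-count
concentration — `Cruxes/ContactAngleEquidistribution/NOTES.md` §B); the equilibrium content of the crux is the
unconditional theorem `eq_contactAngleEquidistribution_const` (every constant profile, `…EqConst.lean`).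
Mechanism of the composition (leads 0–c1): `θe := 1 + sup|θ₀|`; pointwise split of every collision into
isolated-capped + near-field-capped + fast; domination `LG_N ≤ e^{C(N+1)} G_N` (`stub_domination`, p106196);
Donsker–Varadhan bookkeeping (`stub_abstractDV`, p109953); measurability of marked collision sums (`stub_meas`,
p106462). The generic helpers of the skeleton (three-way `ite` split, termwise bounds, measurability of the marks) are
`…TransferTools.lean` (namespace `.Transfer`).

References: C. Kipnis, C. Landim, *Scaling Limits of Interacting Particle Systems* (1999), App. 1 §8 (entropy
inequality); C. Cercignani, R. Illner, M. Pulvirenti, *The Mathematical Theory of Dilute Gases* (1994), App. 4.A.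
-/

noncomputable section

open MeasureTheory Filter Set Topology ProbabilityTheory
open scoped ENNReal BigOperators Classical RealInnerProductSpace

namespace Summit.AtomisticToContinuum.HydrodynamicLimit.Theorems.ContactAngleEquidistributionSketch

open Literature.Analysis.FluidPDE Literature.MathematicalPhysics.KineticTheory
open Summit.AtomisticToContinuum.HydrodynamicLimit.Theses.LambertianContactSwap


open Transfer

/-! ## The composition: the crux from the four named statements -/

/-- **THE TRANSFER KERNEL OF LINE `Sketch`: `ContactAngleEquidistribution` FROM FOUR NAMED STATEMENTS.** If
(i) `hcost` — under the homogeneous Gibbs law `Q_N = localGibbsLaw σ 1 0 θe`, for admissible marks `ψ_N`, the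
ISOLATED speed-capped `κ_g`-centred contact-angle functional `A^V_N` is sub-Gaussian at the CLT scale,
`∫ exp(l (N+1)^{4/3} A^V_N) dQ_N ≤ exp((N+1)^{4/3}(C l² + δ_N |l|))`, `δ_N → 0`, `|l| ≤ l₀`, for every `θe > 0` at
small reduced density; (ii) `NearFieldAdmissibleCosineLawBall` (T1'); (iii) `NearFieldBlockingIsotropyBall` (T2');
(iv) `CollisionMomentBound` (item 12102) — then the crux `ContactAngleEquidistribution` holds. Proof = the certified
composition of the line's skeleton: `θe := 1 + sup |θ₀|`, `σ₀ :=` the minimum of the five thresholds and `1/2`,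
pointwise three-way split, `stub_domination`, `stub_meas`, `stub_nearFieldReductionBall`, `stub_abstractDV`.
[cite: KipnisLandim1999, App. 1 §8] -/
theorem contactAngleEquidistribution_of_kernel
    (hcost :
      let Cfg : ℕ → Type := fun N => Config (N + 1) (Fin 3) T3
      let G := Torus.geometry (Fin 3)
      let ε : ℝ → ℕ → ℝ := hsDiameter
      let τ : ℝ → (N : ℕ) → Cfg N → ℝ≥0∞ := fun σ N z => Alexander.freeExitTime G (ε σ N) z
      let S : ℝ → (N : ℕ) → Cfg N → Cfg N := fun t _ z => freeFlight G t z
      let ldir : V3 → V3 → V3 := fun ω ξ => ‖‖ω‖⁻¹ • ω + ‖ξ‖⁻¹ • ξ‖⁻¹ • (‖ω‖⁻¹ • ω + ‖ξ‖⁻¹ • ξ)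
      let zpre : ℝ → (N : ℕ) → Cfg N → ℕ → Cfg N := fun σ N z m =>
        let y := Alexander.stateAfter G (ε σ N) z m; S (τ σ N y).toReal N y
      let Kt : ℝ → (N : ℕ) → Cfg N → ℝ → ℕ := fun σ N z t => Alexander.collisionCount G (ε σ N) z t
      let hit : ℝ → (N : ℕ) → Cfg N → Fin (N + 1) → Fin (N + 1) → Prop := fun σ N y i j =>
        i < j ∧ y ∈ contactSet G (N + 1) (ε σ N) i j ∧ IsIncoming G y i j
      let tcol : ℝ → (N : ℕ) → Cfg N → ℕ → ℝ := fun σ N z m =>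
        (Alexander.collisionInstant G (ε σ N) z (m + 1)).toReal
      let xmid : (N : ℕ) → Cfg N → Fin (N + 1) → Fin (N + 1) → T3 := fun _ y i j =>
        G.translate (y j).1 ((2 : ℝ)⁻¹ • G.sepVec (y i).1 (y j).1)
      let near : ℝ → (N : ℕ) → Cfg N → Fin (N + 1) → Fin (N + 1) → Prop := fun σ N y i j =>
        ∃ k : Fin (N + 1), k ≠ i ∧ k ≠ j ∧ ‖G.sepVec (y k).1 (xmid N y i j)‖ ≤ 3 * ε σ N
      ∀ θe : ℝ, 0 < θe → ∃ σ₀ : ℝ, 0 < σ₀ ∧ ∀ σ : ℝ, 0 < σ → σ < σ₀ →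
        ∀ Φ : (N : ℕ) → HardSphereFlow G (ε σ N) (N + 1),
        let Q := fun N => localGibbsLaw σ (fun _ => 1) (fun _ => 0) (fun _ => θe) N (Φ N)
        ∀ t : ℝ, 0 ≤ t → ∀ V : ℝ, 0 < V →
        ∀ ψ : ℕ → ℝ → T3 → V3 → V3 → V3 → ℝ,
          (∀ N, Measurable (fun p : ℝ × T3 × V3 × V3 × V3 =>
            ψ N p.1 p.2.1 p.2.2.1 p.2.2.2.1 p.2.2.2.2)) →
          (∀ N s x v w n, |ψ N s x v w n| ≤ 1) →
          (∀ N s x v w (n n' : V3), ‖n‖ = 1 → ‖n'‖ = 1 →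
            |ψ N s x v w n - ψ N s x v w n'| ≤ ‖n - n'‖) →
          ∃ l₀ : ℝ, 0 < l₀ ∧ ∃ C : ℝ, ∃ δ : ℕ → ℝ, Tendsto δ atTop (𝓝 0) ∧ ∀ᶠ N : ℕ in atTop,
            ∀ l : ℝ, |l| ≤ l₀ →
            ∫⁻ z, ENNReal.ofReal (Real.exp (l * ((N : ℝ) + 1) ^ (4 / 3 : ℝ) *
              (((N : ℝ) + 1) ^ (-(4 / 3 : ℝ)) * ∑ m ∈ Finset.range (Kt σ N z t),
              ∑ i : Fin (N + 1), ∑ j : Fin (N + 1),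
                (let y := zpre σ N z m
                 if hit σ N y i j then
                   (if near σ N y i j then 0 else if V < ‖(y i).2 - (y j).2‖ then 0 else
                     ‖(y i).2 - (y j).2‖ ^ 2 *
                       (ψ N (tcol σ N z m) (xmid N y i j) (y i).2 (y j).2
                           ((ε σ N)⁻¹ • G.sepVec (y i).1 (y j).1) -
                         ∫ ξ, ψ N (tcol σ N z m) (xmid N y i j) (y i).2 (y j).2
                           (ldir (-((y i).2 - (y j).2)) ξ) ∂(stdGaussian V3)))
                 else 0)))) ∂(Q N) ≤
              ENNReal.ofReal (Real.exp (((N : ℝ) + 1) ^ (4 / 3 : ℝ) * (C * l ^ 2 + δ N * |l|))))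
    (hT1 : NearFieldAdmissibleCosineLawBall) (hT2 : NearFieldBlockingIsotropyBall)
    (hT : CollisionMomentBound) : ContactAngleEquidistribution := by
  unfold ContactAngleEquidistribution
  intro Cfg G ε τ S ldir zpre Kt hit tcol xmid a₀ θ₀ u₀ ha hθ hu ha0 hθ0
  -- the reference temperature `θe = Mθ + 1 > sup θ₀`
  obtain ⟨Mθ, hMθ0, hMθ⟩ := exists_forall_abs_le_of_continuous hθ
  have hθe : (0 : ℝ) < Mθ + 1 := by linarith
  have hθlt : ∀ x, θ₀ x < Mθ + 1 := fun x => by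
    have := (le_abs_self _).trans (hMθ x)
    linarith
  -- the stubs
  obtain ⟨σ₁, hσ₁, h1⟩ := hcost (Mθ + 1) hθe
  obtain ⟨σ₃, hσ₃, h3⟩ := stub_domination a₀ θ₀ u₀ ha hθ hu ha0 hθ0 (Mθ + 1) hθlt
  have hNF := stub_nearFieldReductionBall hT1 hT2
  obtain ⟨σ₄, hσ₄, h4⟩ := hNF a₀ θ₀ u₀ ha hθ hu ha0 hθ0
  obtain ⟨σ₅, hσ₅, h5⟩ := hT a₀ θ₀ u₀ ha hθ hu ha0 hθ0
  have hM := stub_meas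
  refine ⟨min (min σ₁ (min σ₃ σ₄)) (min σ₅ 2⁻¹),
    lt_min (lt_min hσ₁ (lt_min hσ₃ hσ₄)) (lt_min hσ₅ (by norm_num)), ?_⟩
  intro σ hσ hσlt Φ P t ht ψ hψm hψb hψl
  simp only [lt_min_iff] at hσlt
  obtain ⟨⟨hs1, hs3, hs4⟩, hs5, hsh⟩ := hσlt
  have hσhalf : σ ≤ 1 / 2 := by rw [one_div]; exact hsh.le
  have hPprob : ∀ N, IsProbabilityMeasure (P N) := fun N =>
    isProbabilityMeasure_localGibbsLaw ha hθ hu ha0 hθ0 hσhalf N (Φ N)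
  have hQprob : ∀ N, IsProbabilityMeasure
      (localGibbsLaw σ (fun _ => 1) (fun _ => 0) (fun _ => Mθ + 1) N (Φ N)) := fun N =>
    isProbabilityMeasure_localGibbsLaw continuous_const continuous_const continuous_const
      (fun _ => one_pos) (fun _ => hθe) hσhalf N (Φ N)
  obtain ⟨C, hC⟩ := h3 σ hσ hs3
  -- local names for the marks (same shape as in the stubs' `let` chains)
  let cen : (N : ℕ) → ℝ → Cfg N → Fin (N + 1) → Fin (N + 1) → ℝ := fun N s y i j =>
    ψ N s (xmid N y i j) (y i).2 (y j).2 ((ε σ N)⁻¹ • G.sepVec (y i).1 (y j).1) -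
      ∫ ξ, ψ N s (xmid N y i j) (y i).2 (y j).2 (ldir (-((y i).2 - (y j).2)) ξ) ∂(stdGaussian V3)
  let near : (N : ℕ) → Cfg N → Fin (N + 1) → Fin (N + 1) → Prop := fun N y i j =>
    ∃ k : Fin (N + 1), k ≠ i ∧ k ≠ j ∧ ‖G.sepVec (y k).1 (xmid N y i j)‖ ≤ 3 * ε σ N
  let markA : ℝ → (N : ℕ) → ℝ → Cfg N → Fin (N + 1) → Fin (N + 1) → ℝ := fun V N s y i j =>
    if near N y i j then 0 else if V < ‖(y i).2 - (y j).2‖ then 0 else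
      ‖(y i).2 - (y j).2‖ ^ 2 * cen N s y i j
  let markB : ℝ → (N : ℕ) → ℝ → Cfg N → Fin (N + 1) → Fin (N + 1) → ℝ := fun V N s y i j =>
    if near N y i j then (if V < ‖(y i).2 - (y j).2‖ then 0 else
      ‖(y i).2 - (y j).2‖ ^ 2 * cen N s y i j) else 0
  let markR : ℝ → (N : ℕ) → ℝ → Cfg N → Fin (N + 1) → Fin (N + 1) → ℝ := fun V N s y i j =>
    if V < ‖(y i).2 - (y j).2‖ then ‖(y i).2 - (y j).2‖ ^ 2 * cen N s y i j else 0
  let markW : (N : ℕ) → ℝ → Cfg N → Fin (N + 1) → Fin (N + 1) → ℝ := fun N _ y i j =>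
    1 + ‖((y i).2 - (y j).2)‖ ^ 3
  -- measurability of the marks
  have hcen : ∀ N (i j : Fin (N + 1)), Measurable fun p : ℝ × Cfg N => cen N p.1 p.2 i j :=
    fun N i j => (measurable_markPsi (hψm N) _ i j).sub (measurable_markAvg (hψm N) i j)
  have hnear : ∀ N (i j : Fin (N + 1)), MeasurableSet {p : ℝ × Cfg N | near N p.2 i j} :=
    fun N i j => measurableSet_nearBall _ i j
  have hg : ∀ N (i j : Fin (N + 1)), Measurable fun p : ℝ × Cfg N => ‖(p.2 i).2 - (p.2 j).2‖ :=
    fun N i j => ((measurable_vel₂ i).sub (measurable_vel₂ j)).norm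
  have hcap : ∀ V N (i j : Fin (N + 1)), MeasurableSet {p : ℝ × Cfg N | V < ‖(p.2 i).2 - (p.2 j).2‖} :=
    fun V N i j => measurableSet_lt measurable_const (hg N i j)
  have hmA : ∀ V N (i j : Fin (N + 1)), Measurable fun p : ℝ × Cfg N => markA V N p.1 p.2 i j :=
    fun V N i j => Measurable.ite (hnear N i j) measurable_const
      (Measurable.ite (hcap V N i j) measurable_const (((hg N i j).pow_const 2).mul (hcen N i j)))
  have hmB : ∀ V N (i j : Fin (N + 1)), Measurable fun p : ℝ × Cfg N => markB V N p.1 p.2 i j :=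
    fun V N i j => Measurable.ite (hnear N i j)
      (Measurable.ite (hcap V N i j) measurable_const (((hg N i j).pow_const 2).mul (hcen N i j)))
      measurable_const
  have hmR : ∀ V N (i j : Fin (N + 1)), Measurable fun p : ℝ × Cfg N => markR V N p.1 p.2 i j :=
    fun V N i j => Measurable.ite (hcap V N i j) (((hg N i j).pow_const 2).mul (hcen N i j))
      measurable_const
  have hmW : ∀ N (i j : Fin (N + 1)), Measurable fun p : ℝ × Cfg N => markW N p.1 p.2 i j :=
    fun N i j => measurable_const.add ((hg N i j).pow_const 3)
  -- the centred mark is bounded by 2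
  have hd : ∀ N s (y : Cfg N) (i j : Fin (N + 1)), |cen N s y i j| ≤ 2 := fun N s y i j =>
    abs_sub_avg_le_two _ (ψ N) (hψb N) _ _ _ _ _ _
  -- the normalisation is nonnegative
  have hc : ∀ N : ℕ, (0 : ℝ) ≤ ((N : ℝ) + 1) ^ (-(4 / 3 : ℝ)) := fun N => by positivity
  refine stub_abstractDV (fun N => P N)
    (fun N => localGibbsLaw σ (fun _ => 1) (fun _ => 0) (fun _ => Mθ + 1) N (Φ N)) hPprob hQprob _ _ _ _
    (fun V N z => ((N : ℝ) + 1) ^ (-(4 / 3 : ℝ)) * ∑ m ∈ Finset.range (Kt σ N z t),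
      ∑ i : Fin (N + 1), ∑ j : Fin (N + 1),
        (let y := zpre σ N z m
         if hit σ N y i j then markR V N (tcol σ N z m) y i j else 0))
    ?_ ?_ ?_ ?_ ?_ ?_ (h5 σ hσ hs5 Φ t ht) ?_ ?_ ?_ ⟨C, fun N => hC N (Φ N)⟩
    (fun V hV => h1 σ hσ hs1 Φ t ht V hV ψ hψm hψb hψl)
    (fun V hV => h4 σ hσ hs4 Φ t ht V hV ψ hψm hψb hψl)
  · -- hD : the pointwise three-way split
    intro V hV N z
    exact mul_sum3_split _ _ _ _ _ _ _ fun m i j => ite_split3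
  · -- hAm
    intro V hV N
    exact (hM σ hσ hsh N t (fun s y i j => markA V N s y i j) fun i j => hmA V N i j).const_mul _
  · -- hBm
    intro V hV N
    exact (hM σ hσ hsh N t (fun s y i j => markB V N s y i j) fun i j => hmB V N i j).const_mul _
  · -- hRm
    intro V hV N
    exact (hM σ hσ hsh N t (fun s y i j => markR V N s y i j) fun i j => hmR V N i j).const_mul _
  · -- hWm
    intro N
    exact (hM σ hσ hsh N t (fun s y i j => markW N s y i j) fun i j => hmW N i j).const_mul _
  · -- hW0
    intro N z
    exact mul_sum3_nonneg _ _ (hc N) _ fun m i j => termW_nonneg (norm_nonneg _)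
  · -- hAW
    intro V hV N z
    exact abs_mul_sum3_le _ _ (hc N) 2 _ _ fun m i j =>
      termA_le_W (norm_nonneg _) (hd N _ _ i j)
  · -- hBW
    intro V hV N z
    exact abs_mul_sum3_le _ _ (hc N) 2 _ _ fun m i j =>
      termB_le_W (norm_nonneg _) (hd N _ _ i j)
  · -- hRW
    intro V hV N z
    exact abs_mul_sum3_le _ _ (hc N) (2 / V) _ _ fun m i j =>
      termR_le_W hV (norm_nonneg _) (hd N _ _ i j) fun h => h



end Summit.AtomisticToContinuum.HydrodynamicLimit.Theorems.ContactAngleEquidistributionSketch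

end
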